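import Literature.NumberTheory.Transcendental.ZeroEstMain
import Literature.NumberTheory.Transcendental.ZeroEstStdBridge
import Literature.NumberTheory.Transcendental.PkappaLawFamily
import Literature.NumberTheory.Transcendental.ThetaAnalytic
import Literature.Analysis.Complex.OsgoodProofs
import HarnessLib

/-!
# The theta model of `M_κ` as an analytic group model, and the zero estimate on `M_κ`

Topic `Literature/NumberTheory/Transcendental`. Eighteenth module of the discharge of
`Literature.NumberTheory.Transcendental.philippon1986_std`: the abstract zero estimate
`AnalyticGroupModel.zero_estimate` (`ZeroEstMain.lean`) specialised to the group
`M_κ = 𝔾ₘ^β × P_κ` embedded by the theta functions `Θ_J` of `PkappaTheta.lean`.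

The soft fields of `AnalyticGroupModel` are supplied here from the tree: the coordinates
(`GaGmE.Std.theta`, entire by `ThetaAnalytic.lean`, without common zero by
`exists_theta_ne_zero`), the finite complete family of analytic addition laws
(`PkappaThetaAdditionPoly.lean` + `PkappaLawFamily.lean`: quartic forms in `X` whose coefficients
are entire in the translation parameter, units `λ`, completeness), the boundary forms
`∏_a X_{(a,(M,none))}` and the dimension `n = |β| + |γ| + |δ|`. The four HARD geometric inputs on
the embedding — surjectivity onto the points of the closure off the boundary, the Jacobian
criterion at every point, one point of injective differential, and the quadratic Wronskian forms
of the invariant derivations — are taken as an explicit datum `HardData` (to be supplied by the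
sequel; nothing is asserted). PROVED here:

* `thetaModel H : AnalyticGroupModel (Lie M_κ,ℂ) N` (`N + 1 = |Option β × ThetaIdx γ δ|`);
* `zero_estimate_theta` — Philippon's zero estimate on `M_κ` in the shape of the named fact, with
  the obstruction an abstract closed irreducible subgroup `H₀ ⊆ Lie M_κ,ℂ` of the theta-Zariski
  topology: `binom(T + s, s) · card{σ + H₀} · D^{coneDim H₀ - 1} ≤ c · Dⁿ`;
* `philippon_shape_of_classification` — the statement of `philippon1986_std` for `(L, κ, β, γ, δ)`
  from `HardData` and the classification of the closed irreducible subgroups as the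
  `exp⁻¹(H_{(A,C,Ξ)})` of `GaGmE.Std.SubgroupDataC` (hypothesis `hCL`, the sequel's business).

## References

* P. Philippon, *Lemmes de zéros dans les groupes algébriques commutatifs*, Bull. Soc. Math.
  France 114 (1986), 355–383, Thm. 2.1. [Philippon1986]
* Yu. V. Nesterenko, P. Philippon (eds.), *Introduction to Algebraic Independence Theory*,
  LNM 1752, Springer 2001, Ch. 11 (D. Roy), Thm. 4.1. [NesterenkoPhilippon2001]
-/

noncomputable section

open MvPolynomial Set Module
open scoped Pointwise

namespace Literature.NumberTheory.Transcendental

namespace GaGmE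

namespace Std

variable {β γ δ : Type} [Fintype β] [Fintype γ] [Fintype δ] [DecidableEq γ]
variable (L : PeriodPair) (κM : δ → γ → Kbar)

/-! ### Indexing the theta functions by `Fin (N + 1)` -/

variable (β γ δ) in
/-- `N`, with `N + 1` the number of theta functions of `M_κ`. [folklore] -/
def nIdx : ℕ := Fintype.card (Option β × ThetaIdx γ δ) - 1

variable (β γ δ) in
/-- `N + 1 = |Option β × ThetaIdx γ δ|`. [folklore] -/
theorem nIdx_succ : nIdx β γ δ + 1 = Fintype.card (Option β × ThetaIdx γ δ) := by
  have : 0 < Fintype.card (Option β × ThetaIdx γ δ) :=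
    Fintype.card_pos_iff.mpr ⟨(none, (fun _ => 0, none))⟩
  unfold nIdx; omega

variable (β γ δ) in
/-- The indexing bijection `Fin (N + 1) ≃ Option β × ThetaIdx γ δ`. [folklore] -/
def idxEquiv : Fin (nIdx β γ δ + 1) ≃ Option β × ThetaIdx γ δ :=
  (finCongr (nIdx_succ β γ δ)).trans (Fintype.equivFin _).symm

/-- The theta functions indexed by `Fin (N + 1)`. [folklore] -/
def Θf (J : Fin (nIdx β γ δ + 1)) (w : β ⊕ (γ ⊕ δ) → ℂ) : ℂ := theta L κM (idxEquiv β γ δ J) w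

/-- Evaluation at `Θ(w)` of a transported polynomial is `thetaEval`. [folklore] -/
theorem eval_Θf_rename (P : MvPolynomial (Option β × ThetaIdx γ δ) ℂ) (w : β ⊕ (γ ⊕ δ) → ℂ) :
    eval (fun J => Θf L κM J w) (rename (idxEquiv β γ δ).symm P) = thetaEval L κM P w := by
  simp only [eval_rename, thetaEval, Θf, Function.comp_def, Equiv.apply_symm_apply]

/-! ### The hard geometric data of the embedding -/

/-- **The hard geometric inputs on the theta embedding** (to be PROVED in the sequel; here a
datum): surjectivity of `w ↦ [Θ(w)]` onto the points of `M̄_κ` off the boundary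
`∏_a X_{(a,(M,none))} = 0`, the Jacobian criterion at every point, one point with `n` coordinate
ratios of injective differential, and the quadratic Wronskian forms of the invariant derivations.
[cite: NesterenkoPhilippon2001, Ch. 11 §2.1–§2.3, Lemma 3.1] -/
structure HardData where
  /-- Surjectivity onto the closure off the boundary. -/
  surj : ∀ x : Fin (nIdx β γ δ + 1) → ℂ,
    (∀ (P : MvPolynomial (Fin (nIdx β γ δ + 1)) ℂ) (d : ℕ), P.IsHomogeneous d →
      (∀ w, eval (fun J => Θf L κM J w) P = 0) → eval x P = 0) →
    (∃ u ∈ (Finset.univ : Finset (γ → Fin 3)).image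
        (fun Mc => ∏ a : Option β, (X ((idxEquiv β γ δ).symm (a, (Mc, none))) : MvPolynomial _ ℂ)),
      eval x u ≠ 0) →
    ∃ (c : ℂ) (w : β ⊕ (γ ⊕ δ) → ℂ), x = c • fun J => Θf L κM J w
  /-- Jacobian criterion at every point. -/
  locRel : ∀ w : β ⊕ (γ ⊕ δ) → ℂ, ∃ S : Finset (MvPolynomial (Fin (nIdx β γ δ + 1)) ℂ),
    (∀ P ∈ S, ∃ d, P.IsHomogeneous d) ∧ (∀ P ∈ S, ∀ w', eval (fun J => Θf L κM J w') P = 0) ∧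
    S.card + Fintype.card (β ⊕ (γ ⊕ δ)) = nIdx β γ δ ∧
    LinearIndependent ℂ fun P : S => fun J => eval (fun J' => Θf L κM J' w) (pderiv J (P : MvPolynomial _ ℂ))
  /-- One point of injective differential. -/
  nondeg : ∃ (w₀ : β ⊕ (γ ⊕ δ) → ℂ) (J₀ : Fin (nIdx β γ δ + 1))
      (Js : Fin (Fintype.card (β ⊕ (γ ⊕ δ))) → Fin (nIdx β γ δ + 1)), Θf L κM J₀ w₀ ≠ 0 ∧
    ∀ x : β ⊕ (γ ⊕ δ) → ℂ,
      (∀ i, deriv (fun t : ℂ => Θf L κM (Js i) (w₀ + t • x) / Θf L κM J₀ (w₀ + t • x)) 0 = 0) → x = 0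
  /-- The Wronskian forms. -/
  wronsk : (β ⊕ (γ ⊕ δ) → ℂ) → Fin (nIdx β γ δ + 1) → Fin (nIdx β γ δ + 1) →
    MvPolynomial (Fin (nIdx β γ δ + 1)) ℂ
  /-- They are quadratic. -/
  isHomogeneous_wronsk : ∀ x I J, (wronsk x I J).IsHomogeneous 2
  /-- `Θ_J ∂_xΘ_I - Θ_I ∂_xΘ_J = Q_{x,I,J}(Θ)`. -/
  F_wronsk : ∀ x I J w, Θf L κM J w * deriv (fun t : ℂ => Θf L κM I (w + t • x)) 0 -
    Θf L κM I w * deriv (fun t : ℂ => Θf L κM J (w + t • x)) 0 = eval (fun K => Θf L κM K w) (wronsk x I J)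

/-! ### The soft data -/

/-- **The boundary forms** `∏_a X_{(a,(M,none))}`, `M : γ → Fin 3`. [folklore] -/
def bdryForms : Finset (MvPolynomial (Fin (nIdx β γ δ + 1)) ℂ) :=
  (Finset.univ : Finset (γ → Fin 3)).image
    fun Mc => ∏ a : Option β, (X ((idxEquiv β γ δ).symm (a, (Mc, none))) : MvPolynomial _ ℂ)

/-- The boundary forms are forms of degree `|β| + 1`. [folklore] -/
theorem isHomogeneous_of_mem_bdryForms {u : MvPolynomial (Fin (nIdx β γ δ + 1)) ℂ}
    (hu : u ∈ bdryForms (β := β) (γ := γ) (δ := δ)) : u.IsHomogeneous (Fintype.card (Option β)) := by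
  classical
  obtain ⟨Mc, -, rfl⟩ := Finset.mem_image.mp hu
  have := IsHomogeneous.prod (Finset.univ : Finset (Option β))
    (fun a => (X ((idxEquiv β γ δ).symm (a, (Mc, none))) : MvPolynomial (Fin (nIdx β γ δ + 1)) ℂ))
    (fun _ => 1) fun a _ => isHomogeneous_X ℂ _
  simpa using this

omit [Fintype β] [Fintype δ] in
/-- **At every point some chart `M` has all `Θ_{(a,(M,none))}(w) ≠ 0`**: `M b = 2` on the
lattice points, `M b = 0` off them. [folklore] -/
theorem exists_chart_ne_zero (w : β ⊕ (γ ⊕ δ) → ℂ) :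
    ∃ Mc : γ → Fin 3, ∀ a : Option β, theta L κM (a, (Mc, none)) w ≠ 0 := by
  classical
  let Mc : γ → Fin 3 := fun b => if w (iz b) ∈ L.lattice then 2 else 0
  have hM : ∀ b, L.univExtP (Mc b) (w (iz b)) ≠ 0 := by
    intro b
    by_cases hb : w (iz b) ∈ L.lattice
    · obtain ⟨m', n', hmn⟩ := PeriodPair.mem_lattice.mp hb
      obtain ⟨c, hc, -, -, h2, -⟩ := L.exists_univExtTheta_lattice m' n' 0
      simp only [PeriodPair.univExtTheta_inl] at h2
      have : Mc b = 2 := if_pos hb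
      rw [this, ← hmn, h2]
      exact mul_ne_zero hc (by norm_num)
    · have : Mc b = 0 := if_neg hb
      rw [this, (PeriodPair.univExtP_eq hb).1]
      exact pow_ne_zero _ (L.weierstrassSigma_ne_zero hb)
  refine ⟨Mc, fun a => ?_⟩
  have hP : thetaPnone (β := β) (δ := δ) L Mc w ≠ 0 := Finset.prod_ne_zero_iff.mpr fun b _ => hM b
  rcases a with _ | j
  · simpa [theta] using hP
  · simp only [theta, thetaT_some, thetaP_none]
    exact mul_ne_zero (Complex.exp_ne_zero _) hP

/-- The laws transported to `Fin (N + 1)`: `A^α_I(X, v) = lawPoly(s_α, v)_{I}`. [folklore] -/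
def lawf (α : Fin (2 * Fintype.card γ + 1)) (I : Fin (nIdx β γ δ + 1)) (v : β ⊕ (γ ⊕ δ) → ℂ) :
    MvPolynomial (Fin (nIdx β γ δ + 1)) ℂ :=
  rename (idxEquiv β γ δ).symm (lawPoly L κM (auxPt L α) v (idxEquiv β γ δ I))

/-- Coefficients of a renamed polynomial along an equivalence. [folklore] -/
theorem coeff_rename_equiv (m : Fin (nIdx β γ δ + 1) →₀ ℕ) (Q : MvPolynomial (Option β × ThetaIdx γ δ) ℂ) :
    coeff m (rename (idxEquiv β γ δ).symm Q) = coeff (m.mapDomain (idxEquiv β γ δ)) Q := by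
  have hm : m = (m.mapDomain (idxEquiv β γ δ)).mapDomain (idxEquiv β γ δ).symm := by
    rw [← Finsupp.mapDomain_comp, Equiv.symm_comp_self, Finsupp.mapDomain_id]
  conv_lhs => rw [hm]
  exact coeff_rename_mapDomain _ (idxEquiv β γ δ).symm.injective _ _

/-- **The theta model of `M_κ` as an analytic group model.** [cite: NesterenkoPhilippon2001, Ch. 11 §2.1 (84)] -/
def thetaModel (H : HardData (β := β) L κM) : AnalyticGroupModel (β ⊕ (γ ⊕ δ) → ℂ) (nIdx β γ δ) where
  Θ := fun J w => Θf L κM J w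
  analyticOnNhd_Θ J := analyticOnNhd_theta L κM _
  exists_Θ_ne_zero w := by
    obtain ⟨J, hJ⟩ := exists_theta_ne_zero L κM w
    exact ⟨(idxEquiv β γ δ).symm J, by simpa [Θf] using hJ⟩
  nLaw := 2 * Fintype.card γ + 1
  lawDeg := 4
  lawDeg_pos := by norm_num
  law := fun α I v => lawf L κM α I v
  isHomogeneous_law α I v := (lawPoly_isHomogeneous L κM _ v _).rename_isHomogeneous
  differentiable_coeff_law α I m := by
    simp only [lawf, coeff_rename_equiv]
    exact coeffDifferentiable_lawPoly L κM (auxPt L α) (idxEquiv β γ δ I) _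
  lam α u v := lawUnit (β := β) (δ := δ) L (auxPt L α) u v
  analyticOnNhd_lam α := by
    have hd := differentiable_lawUnit (β := β) (γ := γ) (δ := δ) L (auxPt L α)
    exact Literature.Analysis.Complex.SCV.analyticOnNhd_of_differentiableOn hd.differentiableOn isOpen_univ
  eval_law α I u v := by
    show eval (fun J => Θf L κM J u) (lawf L κM α I v) = lawUnit L (auxPt L α) u v * Θf L κM I (u + v)
    rw [lawf, eval_Θf_rename, thetaEval_lawPoly]
    rfl
  exists_lam_ne_zero u v := exists_lawUnit_auxPt_ne_zero L u v
  bdry := bdryForms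
  isHomogeneous_bdry u hu := ⟨_, Fintype.card_pos (α := Option β), isHomogeneous_of_mem_bdryForms hu⟩
  exists_bdry_ne_zero w := by
    classical
    obtain ⟨Mc, hMc⟩ := exists_chart_ne_zero L κM w
    refine ⟨_, Finset.mem_image_of_mem _ (Finset.mem_univ Mc), ?_⟩
    rw [eval_prod]
    exact Finset.prod_ne_zero_iff.mpr fun a _ => by simpa [Θf] using hMc a
  surj := H.surj
  dim := Fintype.card (β ⊕ (γ ⊕ δ))
  finrank_eq := Module.finrank_fintype_fun_eq_card ℂ
  locRel := H.locRel
  nondeg := H.nondeg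
  wronsk := H.wronsk
  isHomogeneous_wronsk := H.isHomogeneous_wronsk
  F_wronsk := H.F_wronsk

/-- `F_{P'} = thetaEval P` for the transported form `P' = rename e⁻¹ P`. [folklore] -/
theorem F_thetaModel_rename (H : HardData (β := β) L κM) (P : MvPolynomial (Option β × ThetaIdx γ δ) ℂ) (w : β ⊕ (γ ⊕ δ) → ℂ) :
    (thetaModel L κM H).F (rename (idxEquiv β γ δ).symm P) w = thetaEval L κM P w :=
  eval_Θf_rename L κM P w

/-! ### The zero estimate on `M_κ` -/

/-- **Philippon's zero estimate on `M_κ = 𝔾ₘ^β × P_κ`** (theta embedding), with the obstruction a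
closed irreducible subgroup `H₀ ⊆ Lie M_κ,ℂ` of the theta-Zariski topology: for a subspace `𝔟`,
a point `v`, a form `P` of degree `D` with `F_P ≢ 0`, and `S, T`, if `F_P` vanishes to order
`≥ nT + 1` along `𝔟` at `s v` for `0 ≤ s ≤ nS`, then for some such `H₀` and some `v₀` with
`F_P(v₀ + H₀) = 0`,
`binom(T + e, e) · card{σ + H₀ ; σ ∈ Σ} · D^{coneDim H₀ - 1} ≤ c · Dⁿ`,
`e = dim 𝔟 - dim(𝔟 ∩ 𝒯(H₀))`, `c = mainConst`. [cite: Philippon1986, Thm. 2.1]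
[cite: NesterenkoPhilippon2001, Ch. 11 Thm. 4.1] -/
theorem zero_estimate_theta (H : HardData (β := β) L κM) (𝔟 : Submodule ℂ (β ⊕ (γ ⊕ δ) → ℂ)) (v : β ⊕ (γ ⊕ δ) → ℂ)
    {P : MvPolynomial (Option β × ThetaIdx γ δ) ℂ} {D : ℕ} (S T : ℕ) (hP : P.IsHomogeneous D)
    (hP0 : ∃ w, thetaEval L κM P w ≠ 0)
    (hvan : ∀ s : ℕ, s ≤ Fintype.card (β ⊕ (γ ⊕ δ)) * S →
      VanishesAlong 𝔟 (thetaEval L κM P) ((s : ℂ) • v) (Fintype.card (β ⊕ (γ ⊕ δ)) * T + 1)) :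
    ∃ H₀ : AddSubgroup (β ⊕ (γ ⊕ δ) → ℂ), (thetaModel L κM H).IsIrred (H₀ : Set (β ⊕ (γ ⊕ δ) → ℂ)) ∧
      (∃ v₀, ∀ h ∈ H₀, thetaEval L κM P (v₀ + h) = 0) ∧
      (T + (finrank ℂ 𝔟 - finrank ℂ ↥(𝔟 ⊓ AnalyticGroupModel.linSpace ((H₀ : AddSubgroup _) : Set (β ⊕ (γ ⊕ δ) → ℂ))))).choose
          (finrank ℂ 𝔟 - finrank ℂ ↥(𝔟 ⊓ AnalyticGroupModel.linSpace ((H₀ : AddSubgroup _) : Set (β ⊕ (γ ⊕ δ) → ℂ)))) *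
        ((fun σ => σ +ᵥ ((H₀ : AddSubgroup _) : Set (β ⊕ (γ ⊕ δ) → ℂ))) '' AnalyticGroupModel.multiples v S).ncard *
        D ^ ((thetaModel L κM H).coneDim ((H₀ : AddSubgroup _) : Set (β ⊕ (γ ⊕ δ) → ℂ)) - 1) ≤
      (thetaModel L κM H).mainConst * D ^ Fintype.card (β ⊕ (γ ⊕ δ)) := by
  set M := thetaModel L κM H with hM
  have hP' : (rename (idxEquiv β γ δ).symm P).IsHomogeneous D := hP.rename_isHomogeneous
  have hF : M.F (rename (idxEquiv β γ δ).symm P) = thetaEval L κM P := funext (F_thetaModel_rename L κM H P)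
  have hP0' : ∃ w, M.F (rename (idxEquiv β γ δ).symm P) w ≠ 0 := by rw [hF]; exact hP0
  have hdim : M.dim = Fintype.card (β ⊕ (γ ⊕ δ)) := rfl
  have hvan' : ∀ σ ∈ AnalyticGroupModel.sumset (AnalyticGroupModel.multiples v S) M.dim,
      AnalyticGroupModel.VanishesToOrder 𝔟 (M.F (rename (idxEquiv β γ δ).symm P)) σ (M.dim * T + 1) := by
    intro σ hσ
    rw [AnalyticGroupModel.sumset_multiples, AnalyticGroupModel.mem_multiples_iff] at hσ
    obtain ⟨s, hs, rfl⟩ := hσ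
    rw [hF]
    exact (AnalyticGroupModel.vanishesAlong_iff_vanishesToOrder _ _ _ _).mp (hvan s hs)
  obtain ⟨H₀, -, hirr, hv₀, hineq⟩ := M.zero_estimate 𝔟 (AnalyticGroupModel.multiples_finite v S)
    (AnalyticGroupModel.zero_mem_multiples v S) hP' hP0' hvan'
  refine ⟨H₀, hirr, ?_, hineq⟩
  obtain ⟨v₀, hv₀⟩ := hv₀
  exact ⟨v₀, fun h hh => by rw [← hF]; exact hv₀ h hh⟩

/-! ### The shape of the named fact, from the classification of closed irreducible subgroups -/

/-- **`philippon1986_std` for `(L, κ, β, γ, δ)` from the hard data and the classification of the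
closed irreducible subgroups of `Lie M_κ,ℂ`** as the `exp⁻¹(H_{(A,C,Ξ)})` (hypothesis `hCL`: the
subgroup as a set, its lineality space as `Lie`, and `dim Lie ≤ coneDim - 1`).
[cite: Philippon1986, Thm. 2.1] -/
theorem philippon_shape_of_classification (H : HardData (β := β) L κM)
    (hCL : ∀ H₀ : AddSubgroup (β ⊕ (γ ⊕ δ) → ℂ), (thetaModel L κM H).IsIrred (H₀ : Set (β ⊕ (γ ⊕ δ) → ℂ)) →
      ∃ K : SubgroupDataC β γ δ κM, (preimageSubgroup L κM K : Set (β ⊕ (γ ⊕ δ) → ℂ)) = H₀ ∧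
        AnalyticGroupModel.linSpace ((H₀ : AddSubgroup _) : Set (β ⊕ (γ ⊕ δ) → ℂ)) = K.tangent ∧
        finrank ℂ K.tangent + 1 ≤ (thetaModel L κM H).coneDim ((H₀ : AddSubgroup _) : Set (β ⊕ (γ ⊕ δ) → ℂ))) :
    ∃ c : ℝ, 0 < c ∧ ∀ (𝔟 : Submodule ℂ (β ⊕ (γ ⊕ δ) → ℂ)) (v : β ⊕ (γ ⊕ δ) → ℂ)
        (P : MvPolynomial (Option β × ThetaIdx γ δ) ℂ) (D S T : ℕ),
        0 < Module.finrank ℂ 𝔟 → 1 ≤ D → 1 ≤ S → P.IsHomogeneous D → (∃ w, thetaEval L κM P w ≠ 0) →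
        (∀ s : ℕ, s ≤ Fintype.card (β ⊕ (γ ⊕ δ)) * S →
          VanishesAlong 𝔟 (thetaEval L κM P) ((s : ℂ) • v) (Fintype.card (β ⊕ (γ ⊕ δ)) * T + 1)) →
        ∃ K : SubgroupDataC β γ δ κM,
          (∃ w₀, ∀ w ∈ K.tangent, thetaEval L κM P (w₀ + w) = 0) ∧
          (Nat.choose (T + (Module.finrank ℂ 𝔟 - Module.finrank ℂ ↥(𝔟 ⊓ K.tangent)))
              (Module.finrank ℂ 𝔟 - Module.finrank ℂ ↥(𝔟 ⊓ K.tangent)) : ℝ) *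
            (orbitCard L κM K v S : ℝ) * (D : ℝ) ^ Module.finrank ℂ K.tangent ≤
            c * (D : ℝ) ^ Fintype.card (β ⊕ (γ ⊕ δ)) := by
  set M := thetaModel L κM H with hM
  refine ⟨M.mainConst + 1, by positivity, ?_⟩
  intro 𝔟 v P D S T _ hD _ hP hP0 hvan
  obtain ⟨H₀, hirr, ⟨v₀, hv₀⟩, hineq⟩ := zero_estimate_theta L κM H 𝔟 v S T hP hP0 hvan
  obtain ⟨K, hKH, hlin, hdimK⟩ := hCL H₀ hirr
  refine ⟨K, ⟨v₀, fun w hw => hv₀ w ?_⟩, ?_⟩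
  · -- `K.tangent ⊆ exp⁻¹(K) = H₀`
    have : w ∈ (preimageSubgroup L κM K : Set (β ⊕ (γ ⊕ δ) → ℂ)) :=
      AddSubgroup.mem_sup_left (by exact hw)
    rw [hKH] at this
    exact this
  · -- the inequality, read through the dictionary
    set s := Module.finrank ℂ 𝔟 - Module.finrank ℂ ↥(𝔟 ⊓ K.tangent) with hs
    have hs' : Module.finrank ℂ 𝔟 - Module.finrank ℂ ↥(𝔟 ⊓ AnalyticGroupModel.linSpace ((H₀ : AddSubgroup _) : Set (β ⊕ (γ ⊕ δ) → ℂ))) = s := by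
      rw [hs, hlin]
    have hcount : ((fun σ => σ +ᵥ ((H₀ : AddSubgroup _) : Set (β ⊕ (γ ⊕ δ) → ℂ))) '' AnalyticGroupModel.multiples v S).ncard =
        orbitCard L κM K v S := by
      rw [← AnalyticGroupModel.ncard_image_vadd_multiples_eq_orbitCard, hKH]
    rw [hs', hcount] at hineq
    -- `D^{dim K} ≤ D^{coneDim H₀ - 1}`
    have hpow : D ^ Module.finrank ℂ K.tangent ≤ D ^ (M.coneDim ((H₀ : AddSubgroup _) : Set (β ⊕ (γ ⊕ δ) → ℂ)) - 1) :=
      Nat.pow_le_pow_right hD (by omega)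
    have hnat : (T + s).choose s * orbitCard L κM K v S * D ^ Module.finrank ℂ K.tangent ≤
        M.mainConst * D ^ Fintype.card (β ⊕ (γ ⊕ δ)) :=
      (Nat.mul_le_mul_left _ hpow).trans hineq
    have hreal : ((T + s).choose s : ℝ) * (orbitCard L κM K v S : ℝ) * (D : ℝ) ^ Module.finrank ℂ K.tangent ≤
        (M.mainConst : ℝ) * (D : ℝ) ^ Fintype.card (β ⊕ (γ ⊕ δ)) := by exact_mod_cast hnat
    refine hreal.trans ?_
    have : (0 : ℝ) ≤ (D : ℝ) ^ Fintype.card (β ⊕ (γ ⊕ δ)) := by positivity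
    nlinarith

end Std

end GaGmE

end Literature.NumberTheory.Transcendental
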